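import Summits.HodgeConjecture.CorCM.PairFlipSexticTimesReflexOcticHodge
import HarnessLib

/-!
# The two HAMMING-BALL types of the reflex slot are NONDEGENERATE

COR-CM (cell `pub-hodgecm2`, binder seat `b16` gen 45, count-neutral claim REFLEX-OCTIC-34, file F8); NEW as stated, hence
under `Summits/`.  Theorems only; no definition, no named fact, no `sorry`.

Setting of `PairFlipSexticReflexSlotCube` / `PairFlipSexticTimesReflexOcticHodge`: the pair-flip slot `Z` with
`Φ₀ = {x₁, x₂, x₃}` and flips `φ₁, φ₂, φ₃`, its reflex slot `Y` (`T : Y → Set Z`, `T(y₀) = Φ₀`; the cube of the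
eight attached types).  The collapse theorem of `PairFlipSexticTimesReflexOcticHodge` says that the pair `(Φ₀, Ψ)` is
degenerate with `rank(Φ₀, Ψ) = rank(Ψ)` exactly when `Ψ` is one of the two Hamming balls (`y₀` and its three
flip-neighbours `φ_iy₀` all in `Ψ`, or all outside).  Here: THESE TWO TYPES ARE NONDEGENERATE (Dodson's orbit
"`[(ℤ₂)⁴]⁺(odd)`" of Prop. 5.2.2, nondegenerate by his minimal weight criterion), so the collapse is a genuinely new source
of exceptional Hodge classes: `F` is a SIMPLE CM fourfold WITHOUT exceptional classes on its own powers, `T` a simple CM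
threefold without exceptional classes on its powers, the two CM fields share no imaginary quadratic subfield, and yet
`T × F^b` carries exceptional Hodge classes.

* abstract (`ReflexSlot.typeRank_eq_five_of_ball`): for a CM type `Ψ ⊆ Y` whose sign vector `u` takes the same value
  `ε = ±1` at `y₀, φ₁y₀, φ₂y₀, φ₃y₀`, the span `U(Ψ)` contains the three coordinate signs `sgn_{x_i}` (cube identity of
  `PairFlipSexticReflexSlotCube`: `¼(u − u∘φ₁ + u∘φ₂ − u∘φ₁φ₂) = ¼S₁·sgn₁` with `S₁ = 2ε ≠ 0`) and the vector
  `m = u − u∘φ₁ − u∘φ₂ + u∘φ₁φ₂`, and these four are linearly independent (values at `y₀, φ₂y₀, φ₃y₀, φ₂φ₃y₀`); with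
  `rank ≤ |Y|/2 + 1 = 5` this gives `rank(Ψ) = 5`;
* number fields (`isNondegenerate_of_reflexOctic_ball`): in the setting of `PairFlipSexticTimesReflexOcticHodge`, a type
  `Ψ` of `K_{i₁}` containing `ψ₀` and its three flip-neighbours (or none of them) is NONDEGENERATE; hence
  (`exists_exceptional_prod_of_reflexOctic_ball_nondegenerate`) the exotic pairs of that file have BOTH factors
  nondegenerate.

## References

* [Dodson1984] B. Dodson, *The structure of Galois groups of CM-fields*, Trans. AMS 283 (1984), Prop. 5.2.2 and §3.3.2.
* [Gordon1999HodgeAVSurvey] B. B. Gordon, *A survey of the Hodge conjecture for abelian varieties*, 7.5–7.7.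
-/

set_option autoImplicit false

noncomputable section

open scoped BigOperators Classical

namespace Summit.HodgeConjecture.CorCM

namespace ReflexSlot

open Literature.NumberTheory.ComplexMultiplication

variable {G : Type*} [Group G] {Z Y : Type*} [MulAction G Z] [MulAction G Y] {ρ : G} {Φ₀ : Set Z}
  {T : Y → Set Z} {y₀ : Y} {x₁ x₂ x₃ : Z} {φ₁ φ₂ φ₃ : G}

/-! ### §1 More products of flips on `Y` -/

/-- **`φ₂φ₂` acts trivially, `φ₁φ₂φ₃` acts as `ρ`, `ρφ₁φ₃` acts as `φ₂` on `Y`.** [cite: Dodson1984, §5.1] -/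
theorem flip_products_smul (hΦ : IsCMTypeWith ρ Φ₀)
    (hT : ∀ (g : G) (y : Y) (x : Z), x ∈ T (g • y) ↔ g⁻¹ • x ∈ T y) (hTi : Function.Injective T)
    (hx : Φ₀ = {x₁, x₂, x₃}) (h12 : x₁ ≠ x₂) (h13 : x₁ ≠ x₃) (h23 : x₂ ≠ x₃)
    (hφ₁ : φ₁ • x₁ = ρ • x₁ ∧ ∀ z : Z, z ≠ x₁ → z ≠ ρ • x₁ → φ₁ • z = z)
    (hφ₂ : φ₂ • x₂ = ρ • x₂ ∧ ∀ z : Z, z ≠ x₂ → z ≠ ρ • x₂ → φ₂ • z = z)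
    (hφ₃ : φ₃ • x₃ = ρ • x₃ ∧ ∀ z : Z, z ≠ x₃ → z ≠ ρ • x₃ → φ₃ • z = z) (y : Y) :
    φ₂ • φ₂ • y = y ∧ φ₁ • φ₂ • φ₃ • y = ρ • y ∧ ρ • φ₁ • φ₃ • y = φ₂ • y := by
  obtain ⟨m₁, m₂, m₃⟩ := mem_of_eq_triple hx
  have f12 := pairFlip_smul_eq_of_mem hΦ m₁ m₂ h12.symm hφ₁.2
  have f13 := pairFlip_smul_eq_of_mem hΦ m₁ m₃ h13.symm hφ₁.2
  have f21 := pairFlip_smul_eq_of_mem hΦ m₂ m₁ h12 hφ₂.2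
  have f23 := pairFlip_smul_eq_of_mem hΦ m₂ m₃ h23.symm hφ₂.2
  have f31 := pairFlip_smul_eq_of_mem hΦ m₃ m₁ h13 hφ₃.2
  have f32 := pairFlip_smul_eq_of_mem hΦ m₃ m₂ h23 hφ₃.2
  refine ⟨?_, ?_, ?_⟩
  · rw [← mul_smul, show y = (1 : G) • y from (one_smul G y).symm]
    refine (smul_eq_smul_of_forall_smul_eq hT hTi (forall_smul_eq_of_forall_mem hΦ
      (forall_mem_of_triple hx ?_ ?_ ?_)) _).trans (by rw [one_smul, one_smul])
    · rw [mul_smul, one_smul, f21.1, f21.1]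
    · rw [mul_smul, one_smul, hφ₂.1, smul_rho_eq_of_pairFlip hΦ hφ₂.1]
    · rw [mul_smul, one_smul, f23.1, f23.1]
  · rw [← mul_smul, ← mul_smul]
    refine smul_eq_smul_of_forall_smul_eq hT hTi (forall_smul_eq_of_forall_mem hΦ
      (forall_mem_of_triple hx ?_ ?_ ?_)) y
    · rw [mul_smul, mul_smul, f31.1, f21.1, hφ₁.1]
    · rw [mul_smul, mul_smul, f32.1, hφ₂.1, f12.2]
    · rw [mul_smul, mul_smul, hφ₃.1, f23.2, f13.2]
  · rw [← mul_smul, ← mul_smul]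
    refine smul_eq_smul_of_forall_smul_eq hT hTi (forall_smul_eq_of_forall_mem hΦ
      (forall_mem_of_triple hx ?_ ?_ ?_)) y
    · rw [mul_smul, mul_smul, f31.1, hφ₁.1, hΦ.invol, f21.1]
    · rw [mul_smul, mul_smul, f32.1, f12.1, hφ₂.1]
    · rw [mul_smul, mul_smul, hφ₃.1, f13.2, hΦ.invol, f23.1]

variable [Fintype Y]

/-- **The Hamming-ball types have rank `5`** (NONDEGENERATE, `5 = 8/2 + 1`): for a CM type `Ψ ⊆ Y` whose sign vector
`u = u_1(Ψ)` takes one value `ε = ±1` at `y₀, φ₁y₀, φ₂y₀, φ₃y₀`, `U(Ψ)` contains `sgn_{x₁}, sgn_{x₂}, sgn_{x₃}` and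
`m = u − u∘φ₁ − u∘φ₂ + u∘φ₁φ₂`, four independent vectors. [cite: Dodson1984, Prop. 5.2.2] -/
theorem typeRank_eq_five_of_ball [MulAction.IsPretransitive G Z] (hΦ : IsCMTypeWith ρ Φ₀)
    (hT : ∀ (g : G) (y : Y) (x : Z), x ∈ T (g • y) ↔ g⁻¹ • x ∈ T y) (hTi : Function.Injective T)
    (hT₀ : T y₀ = Φ₀) (hY : ∀ y : Y, ∃ g : G, g • y₀ = y) (hx : Φ₀ = {x₁, x₂, x₃}) (h12 : x₁ ≠ x₂)
    (h13 : x₁ ≠ x₃) (h23 : x₂ ≠ x₃)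
    (hφ₁ : φ₁ • x₁ = ρ • x₁ ∧ ∀ z : Z, z ≠ x₁ → z ≠ ρ • x₁ → φ₁ • z = z)
    (hφ₂ : φ₂ • x₂ = ρ • x₂ ∧ ∀ z : Z, z ≠ x₂ → z ≠ ρ • x₂ → φ₂ • z = z)
    (hφ₃ : φ₃ • x₃ = ρ • x₃ ∧ ∀ z : Z, z ≠ x₃ → z ≠ ρ • x₃ → φ₃ • z = z)
    {Ψ : Set Y} (hΨ : IsCMTypeWith ρ Ψ) {ε : ℚ} (hε : ε = 1 ∨ ε = -1)
    (hv : antiVec Ψ (1 : G) y₀ = ε ∧ antiVec Ψ (1 : G) (φ₁ • y₀) = ε ∧ antiVec Ψ (1 : G) (φ₂ • y₀) = ε ∧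
      antiVec Ψ (1 : G) (φ₃ • y₀) = ε) :
    typeRank G Ψ = 5 := by
  obtain ⟨m₁, m₂, m₃⟩ := mem_of_eq_triple hx
  have hε0 : ε ≠ 0 := by rcases hε with rfl | rfl <;> norm_num
  set u : Y → ℚ := antiVec Ψ (1 : G) with hu'
  have hu : ∀ y, u (ρ • y) = -u y := fun y => (mem_antiWeights_iff'.1 (antiVec_mem_antiWeights hΨ 1)) y
  obtain ⟨v₀, v₁, v₂, v₃⟩ := hv
  -- coordinates on the face through `y₀`
  have b₁ : x₁ ∈ T y₀ := by rw [hT₀]; exact m₁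
  have b₂ : x₂ ∈ T y₀ := by rw [hT₀]; exact m₂
  have b₃ : x₃ ∈ T y₀ := by rw [hT₀]; exact m₃
  have c₂ := mem_typeMap_pairFlip_smul hΦ hT hT₀ hY hx h12 h23 hφ₂
  have hx' : Φ₀ = {x₁, x₃, x₂} := by rw [hx, Set.pair_comm x₂ x₃]
  have c₃ := mem_typeMap_pairFlip_smul hΦ hT hT₀ hY hx' h13 h23.symm hφ₃
  -- products of flips
  have P := flip_products_smul hΦ hT hTi hx h12 h13 h23 hφ₁ hφ₂ hφ₃
  have e₁ : ∀ y, φ₁ • y = ρ • φ₂ • φ₃ • y := fun y => by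
    rw [← rho_smul_pairFlip_smul hΦ hT hTi hx h12 h13 h23 hφ₁ hφ₂ hφ₃ y, rho_smul_rho_smul hΦ hT hTi]
  have e₁₂ : ∀ y, φ₁ • φ₂ • y = ρ • φ₃ • y := fun y => by
    rw [← rho_smul_pairFlip_smul_pairFlip_smul hΦ hT hTi hx h12 h13 h23 hφ₁ hφ₂ hφ₃ y, rho_smul_rho_smul hΦ hT hTi]
  -- values of `u` at the eight relevant points
  have us : u (φ₂ • φ₃ • y₀) = -ε := by
    have := v₁; rw [e₁, hu] at this; linarith
  -- the four vectors in `U(Ψ)`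
  set s₁ : Y → ℚ := fun y => if x₁ ∈ T y then (1 : ℚ) else -1 with hs₁
  set s₂ : Y → ℚ := fun y => if x₂ ∈ T y then (1 : ℚ) else -1 with hs₂
  set s₃ : Y → ℚ := fun y => if x₃ ∈ T y then (1 : ℚ) else -1 with hs₃
  set m : Y → ℚ := fun y => u y - u (φ₁ • y) - u (φ₂ • y) + u ((φ₁ * φ₂) • y) with hm
  have gen : ∀ g : G, (fun y => u (g • y)) ∈ antiSpan G Ψ := fun g => by
    have : (fun y => u (g • y)) = antiVec Ψ g := by funext y; rw [hu', antiVec_apply_smul, one_mul]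
    rw [this]; exact Submodule.subset_span ⟨g, rfl⟩
  have gen1 : u ∈ antiSpan G Ψ := by simpa using gen 1
  have hmU : m ∈ antiSpan G Ψ := by
    have : m = u - (fun y => u (φ₁ • y)) - (fun y => u (φ₂ • y)) + fun y => u ((φ₁ * φ₂) • y) := by
      funext y; simp only [hm, Pi.add_apply, Pi.sub_apply]
    rw [this]
    exact Submodule.add_mem _ (Submodule.sub_mem _ (Submodule.sub_mem _ gen1 (gen φ₁)) (gen φ₂)) (gen _)
  -- point identities
  have q2 : φ₂ • φ₂ • y₀ = y₀ := (P y₀).1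
  have q123 : φ₁ • φ₂ • φ₃ • y₀ = ρ • y₀ := (P y₀).2.1
  have q13 : φ₁ • φ₃ • y₀ = ρ • φ₂ • y₀ := by
    rw [← (P y₀).2.2, rho_smul_rho_smul hΦ hT hTi]
  have q223 : φ₂ • φ₂ • φ₃ • y₀ = φ₃ • y₀ := (P (φ₃ • y₀)).1
  -- values of `u`
  have uρ : u (ρ • y₀) = -ε := by rw [hu, v₀]
  have uρ2 : u (ρ • φ₂ • y₀) = -ε := by rw [hu, v₂]
  have uρ3 : u (ρ • φ₃ • y₀) = -ε := by rw [hu, v₃]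
  have u12 : u (φ₁ • φ₂ • y₀) = -ε := by rw [e₁₂, uρ3]
  have u13 : u (φ₁ • φ₃ • y₀) = -ε := by rw [q13, uρ2]
  have u123 : u (φ₁ • φ₂ • φ₃ • y₀) = -ε := by rw [q123, uρ]
  -- the three face sums are `2ε`
  have hx₂ : Φ₀ = {x₂, x₁, x₃} := by rw [hx, Set.insert_comm]
  have hx₃ : Φ₀ = {x₃, x₁, x₂} := by
    rw [hx, Set.insert_comm x₁ x₂, Set.pair_comm x₁ x₃, Set.insert_comm x₂ x₃, Set.pair_comm x₂ x₁]
  have F₁ : (∑ y ∈ Finset.univ.filter (fun y => x₁ ∈ T y), u y) = 2 * ε := by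
    have f := sum_filter_mem_typeMap_iff hΦ hT hTi hT₀ hY hx h12 h13 h23 hφ₂ hφ₃ u y₀
    rw [show (Finset.univ.filter fun y => x₁ ∈ T y) = Finset.univ.filter (fun y' => (x₁ ∈ T y' ↔ x₁ ∈ T y₀)) from
      Finset.filter_congr fun y _ => by simp [b₁], f, v₀, v₂, v₃, us]
    ring
  have F₂ : (∑ y ∈ Finset.univ.filter (fun y => x₂ ∈ T y), u y) = 2 * ε := by
    have f := sum_filter_mem_typeMap_iff hΦ hT hTi hT₀ hY hx₂ h12.symm h23 h13 hφ₁ hφ₃ u y₀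
    rw [show (Finset.univ.filter fun y => x₂ ∈ T y) = Finset.univ.filter (fun y' => (x₂ ∈ T y' ↔ x₂ ∈ T y₀)) from
      Finset.filter_congr fun y _ => by simp [b₂], f, v₀, v₁, v₃, u13]
    ring
  have F₃ : (∑ y ∈ Finset.univ.filter (fun y => x₃ ∈ T y), u y) = 2 * ε := by
    have f := sum_filter_mem_typeMap_iff hΦ hT hTi hT₀ hY hx₃ h13.symm h23.symm h12 hφ₁ hφ₂ u y₀
    rw [show (Finset.univ.filter fun y => x₃ ∈ T y) = Finset.univ.filter (fun y' => (x₃ ∈ T y' ↔ x₃ ∈ T y₀)) from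
      Finset.filter_congr fun y _ => by simp [b₃], f, v₀, v₁, v₂, u12]
    ring
  -- the coordinate signs lie in `U(Ψ)`
  have sgn_mem : ∀ {a b c : Z} {φa φb φc : G}, Φ₀ = {a, b, c} → a ≠ b → a ≠ c → b ≠ c →
      (φa • a = ρ • a ∧ ∀ z : Z, z ≠ a → z ≠ ρ • a → φa • z = z) →
      (φb • b = ρ • b ∧ ∀ z : Z, z ≠ b → z ≠ ρ • b → φb • z = z) →
      (φc • c = ρ • c ∧ ∀ z : Z, z ≠ c → z ≠ ρ • c → φc • z = z) →
      (∑ y ∈ Finset.univ.filter (fun y => a ∈ T y), u y) = 2 * ε →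
      (fun y => if a ∈ T y then (1 : ℚ) else -1) ∈ antiSpan G Ψ := by
    intro a b c φa φb φc habc hab hac hbc ha hb hc hS
    have hcube := sub_add_sub_eq_faceSum_mul_sign hΦ hT hTi hT₀ hY habc hab hac hbc ha hb hc hu
    have hmem : (u - (fun y => u (φa • y)) + (fun y => u (φb • y)) - fun y => u ((φa * φb) • y)) ∈ antiSpan G Ψ :=
      Submodule.sub_mem _ (Submodule.add_mem _ (Submodule.sub_mem _ gen1 (gen φa)) (gen φb)) (gen _)
    have heq : (fun y => if a ∈ T y then (1 : ℚ) else -1) =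
        (2 * ε)⁻¹ • (u - (fun y => u (φa • y)) + (fun y => u (φb • y)) - fun y => u ((φa * φb) • y)) := by
      funext y
      simp only [Pi.smul_apply, Pi.add_apply, Pi.sub_apply, smul_eq_mul]
      rw [hcube y, hS, ← mul_assoc, inv_mul_cancel₀ (mul_ne_zero two_ne_zero hε0), one_mul]
    rw [heq]
    exact Submodule.smul_mem _ _ hmem
  have hs₁U : s₁ ∈ antiSpan G Ψ := sgn_mem hx h12 h13 h23 hφ₁ hφ₂ hφ₃ F₁
  have hs₂U : s₂ ∈ antiSpan G Ψ := sgn_mem hx₂ h12.symm h23 h13 hφ₂ hφ₁ hφ₃ F₂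
  have hs₃U : s₃ ∈ antiSpan G Ψ := sgn_mem hx₃ h13.symm h23.symm h12 hφ₃ hφ₁ hφ₂ F₃
  -- values of `m` on the face through `y₀`
  have mp : m y₀ = -2 * ε := by
    simp only [hm, mul_smul]; rw [v₀, v₁, v₂, u12]; ring
  have mq : m (φ₂ • y₀) = 2 * ε := by
    simp only [hm, mul_smul]; rw [v₂, u12, q2, v₀, v₁]; ring
  have mr : m (φ₃ • y₀) = 2 * ε := by
    simp only [hm, mul_smul]; rw [v₃, u13, us, u123]; ring
  have ms : m (φ₂ • φ₃ • y₀) = -2 * ε := by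
    simp only [hm, mul_smul]; rw [us, u123, q223, v₃, u13]; ring
  -- linear independence of `s₁, s₂, s₃, m`
  have hli : LinearIndependent ℚ ![s₁, s₂, s₃, m] := by
    rw [Fintype.linearIndependent_iff]
    intro c hc
    have e₀ := congrFun hc y₀
    have e₂ := congrFun hc (φ₂ • y₀)
    have e₃ := congrFun hc (φ₃ • y₀)
    have e₄ := congrFun hc (φ₂ • φ₃ • y₀)
    simp only [Fin.sum_univ_four, Matrix.cons_val_zero, Matrix.cons_val_one, Matrix.cons_val_two,
      Matrix.cons_val_three, Matrix.tail_cons, Matrix.head_cons, Pi.add_apply, Pi.smul_apply, Pi.zero_apply,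
      smul_eq_mul, hs₁, hs₂, hs₃, b₁, b₂, b₃, (c₂ y₀).1, (c₂ y₀).2.1, (c₂ y₀).2.2, (c₃ y₀).1, (c₃ y₀).2.1,
      (c₃ y₀).2.2, (c₂ (φ₃ • y₀)).1, (c₂ (φ₃ • y₀)).2.1, (c₂ (φ₃ • y₀)).2.2, if_true, if_false, not_true_eq_false,
      mp, mq, mr, ms] at e₀ e₂ e₃ e₄
    have h0 : c 0 = 0 := by rcases hε with rfl | rfl <;> linarith
    have h3 : c 3 = 0 := by
      rcases hε with rfl | rfl
      · linarith
      · linarith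
    have h1 : c 1 = 0 := by rcases hε with rfl | rfl <;> linarith
    have h2 : c 2 = 0 := by rcases hε with rfl | rfl <;> linarith
    intro i
    fin_cases i <;> (try simp only [Fin.isValue, Fin.mk_one, Fin.reduceFinMk]) <;> assumption
  -- dimension count
  haveI : Nonempty Y := ⟨y₀⟩
  have h4 : 4 ≤ Module.finrank ℚ (antiSpan G Ψ) := by
    have hle : Submodule.span ℚ (Set.range ![s₁, s₂, s₃, m]) ≤ antiSpan G Ψ := by
      rw [Submodule.span_le]
      rintro _ ⟨i, rfl⟩
      fin_cases i
      · exact hs₁U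
      · exact hs₂U
      · exact hs₃U
      · exact hmU
    have h := Submodule.finrank_mono hle
    rw [finrank_span_eq_card hli, Fintype.card_fin] at h
    exact h
  have hle := hΨ.typeRank_le
  rw [card_eq_eight hΦ hT hTi hT₀ hY hx h12 h13 h23 hφ₂ hφ₃] at hle
  rw [hΨ.typeRank_eq_finrank_antiSpan_add_one] at hle ⊢
  omega

end ReflexSlot

/-! ### §2 Number fields: the Hamming-ball types are nondegenerate -/

section Types

open NumberField Module
open Literature.NumberTheory.ComplexMultiplication
open Literature.AlgebraicGeometry.Motives (CMType)
open Literature.AlgebraicGeometry.Pohlmann1968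

variable {I : Type} {K : I → Type} [∀ i, Field (K i)] [∀ i, NumberField (K i)] [∀ i, IsCMField (K i)] [Fintype I]

omit [Fintype I] in
/-- **The Hamming-ball types of the reflex field are NONDEGENERATE.**  `K_{i₀}` sextic with pair flips, type `Φ_T`;
`ψ₀` an embedding of `K_{i₁}` with `Fix(ψ₀) = Stab(Φ_T)`; if `Ψ = Φ_{i₁}` contains `ψ₀` together with `σψ₀` for every
pair flip `σ` at a point of `Φ_T` (or none of these four embeddings), then `Ψ` is nondegenerate (`rank 5`).
[cite: Dodson1984, Prop. 5.2.2] -/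
theorem isNondegenerate_of_reflexOctic_ball {i₀ i₁ : I} (h6 : finrank ℚ (K i₀) = 6)
    (hflip : ∀ s : K i₀ →+* ℂ, ∃ σ : ℂ ≃+* ℂ, σ • s = (starRingAut : ℂ ≃+* ℂ) • s ∧
      ∀ t : K i₀ →+* ℂ, t ≠ s → t ≠ (starRingAut : ℂ ≃+* ℂ) • s → σ • t = t)
    (Φ : ∀ i, CMType (K i)) {ψ₀ : K i₁ →+* ℂ}
    (hψ₀ : ∀ σ : ℂ ≃+* ℂ, σ • ψ₀ = ψ₀ ↔ ∀ x : K i₀ →+* ℂ, σ • x ∈ (Φ i₀).1 ↔ x ∈ (Φ i₀).1)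
    (hball : (ψ₀ ∈ (Φ i₁).1 ∧ ∀ (x : K i₀ →+* ℂ) (σ : ℂ ≃+* ℂ), x ∈ (Φ i₀).1 →
        σ • x = (starRingAut : ℂ ≃+* ℂ) • x →
        (∀ t : K i₀ →+* ℂ, t ≠ x → t ≠ (starRingAut : ℂ ≃+* ℂ) • x → σ • t = t) → σ • ψ₀ ∈ (Φ i₁).1) ∨
      (ψ₀ ∉ (Φ i₁).1 ∧ ∀ (x : K i₀ →+* ℂ) (σ : ℂ ≃+* ℂ), x ∈ (Φ i₀).1 →
        σ • x = (starRingAut : ℂ ≃+* ℂ) • x →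
        (∀ t : K i₀ →+* ℂ, t ≠ x → t ≠ (starRingAut : ℂ ≃+* ℂ) • x → σ • t = t) → σ • ψ₀ ∉ (Φ i₁).1)) :
    IsNondegenerate (Φ i₁) := by
  obtain ⟨T, x₁, x₂, x₃, φ₁, φ₂, φ₃, hT, hTi, hT₀, hY, hx, h12, h13, h23, hφ₁, hφ₂, hφ₃⟩ :=
    exists_reflexSlot_data h6 hflip Φ hψ₀
  obtain ⟨m₁, m₂, m₃⟩ := ReflexSlot.mem_of_eq_triple hx
  haveI := isPretransitive_ringEquiv_complex (K := K i₀)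
  have hΨ := isCMTypeWith_conj (Φ i₁)
  have vin : ∀ {y : K i₁ →+* ℂ}, y ∈ (Φ i₁).1 → antiVec (Φ i₁).1 (1 : ℂ ≃+* ℂ) y = 1 := fun {y} hy => by
    rw [antiVec, translateInd_of_mem (show (1 : ℂ ≃+* ℂ) • y ∈ (Φ i₁).1 by rwa [one_smul])]; norm_num
  have vout : ∀ {y : K i₁ →+* ℂ}, y ∉ (Φ i₁).1 → antiVec (Φ i₁).1 (1 : ℂ ≃+* ℂ) y = -1 := fun {y} hy => by
    rw [antiVec, translateInd_of_not_mem (show (1 : ℂ ≃+* ℂ) • y ∉ (Φ i₁).1 by rwa [one_smul])]; norm_num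
  have h5 : typeRank (ℂ ≃+* ℂ) (Φ i₁).1 = 5 := by
    rcases hball with ⟨h0, hall⟩ | ⟨h0, hall⟩
    · exact ReflexSlot.typeRank_eq_five_of_ball (isCMTypeWith_conj (Φ i₀)) hT hTi hT₀ hY hx h12 h13 h23 hφ₁ hφ₂ hφ₃
        hΨ (Or.inl rfl) ⟨vin h0, vin (hall x₁ φ₁ m₁ hφ₁.1 hφ₁.2), vin (hall x₂ φ₂ m₂ hφ₂.1 hφ₂.2),
          vin (hall x₃ φ₃ m₃ hφ₃.1 hφ₃.2)⟩
    · exact ReflexSlot.typeRank_eq_five_of_ball (isCMTypeWith_conj (Φ i₀)) hT hTi hT₀ hY hx h12 h13 h23 hφ₁ hφ₂ hφ₃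
        hΨ (Or.inr rfl) ⟨vout h0, vout (hall x₁ φ₁ m₁ hφ₁.1 hφ₁.2), vout (hall x₂ φ₂ m₂ hφ₂.1 hφ₂.2),
          vout (hall x₃ φ₃ m₃ hφ₃.1 hφ₃.2)⟩
  rw [isNondegenerate_iff, finrank_eq_eight_of_reflexOctic h6 hflip Φ hψ₀]
  exact h5

/-- **The exotic pairs of `PairFlipSexticTimesReflexOcticHodge` have BOTH MEMBERS NONDEGENERATE**: on the Hamming
balls `Φ_T` and `Ψ` are nondegenerate (no exceptional Hodge classes on the powers of `T`, nor on the powers of `F`),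
yet the family `(Φ_T, Ψ)` is DEGENERATE — the exceptional classes on `T × F^b` come from the pairing alone.
[cite: Dodson1984, Prop. 5.2.2 and §3.3.2] [cite: Gordon1999HodgeAVSurvey, 7.5–7.7] -/
theorem isNondegenerate_and_not_isNondegenerateFamily_of_reflexOctic_ball {i₀ i₁ : I} (h01 : i₀ ≠ i₁)
    (hI : ∀ j, j = i₀ ∨ j = i₁) (h6 : finrank ℚ (K i₀) = 6)
    (hflip : ∀ s : K i₀ →+* ℂ, ∃ σ : ℂ ≃+* ℂ, σ • s = (starRingAut : ℂ ≃+* ℂ) • s ∧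
      ∀ t : K i₀ →+* ℂ, t ≠ s → t ≠ (starRingAut : ℂ ≃+* ℂ) • s → σ • t = t)
    (Φ : ∀ i, CMType (K i)) {ψ₀ : K i₁ →+* ℂ}
    (hψ₀ : ∀ σ : ℂ ≃+* ℂ, σ • ψ₀ = ψ₀ ↔ ∀ x : K i₀ →+* ℂ, σ • x ∈ (Φ i₀).1 ↔ x ∈ (Φ i₀).1)
    (hball : (ψ₀ ∈ (Φ i₁).1 ∧ ∀ (x : K i₀ →+* ℂ) (σ : ℂ ≃+* ℂ), x ∈ (Φ i₀).1 →
        σ • x = (starRingAut : ℂ ≃+* ℂ) • x →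
        (∀ t : K i₀ →+* ℂ, t ≠ x → t ≠ (starRingAut : ℂ ≃+* ℂ) • x → σ • t = t) → σ • ψ₀ ∈ (Φ i₁).1) ∨
      (ψ₀ ∉ (Φ i₁).1 ∧ ∀ (x : K i₀ →+* ℂ) (σ : ℂ ≃+* ℂ), x ∈ (Φ i₀).1 →
        σ • x = (starRingAut : ℂ ≃+* ℂ) • x →
        (∀ t : K i₀ →+* ℂ, t ≠ x → t ≠ (starRingAut : ℂ ≃+* ℂ) • x → σ • t = t) → σ • ψ₀ ∉ (Φ i₁).1)) :
    IsNondegenerate (Φ i₀) ∧ IsNondegenerate (Φ i₁) ∧ ¬ CMAlgebra.IsNondegenerateFamily Φ :=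
  ⟨GenericCMField.isNondegenerate_of_pairFlip hflip (Φ i₀), isNondegenerate_of_reflexOctic_ball h6 hflip Φ hψ₀ hball,
    not_isNondegenerateFamily_of_reflexOctic_ball h01 hI h6 hflip Φ hψ₀ hball⟩

end Types

end Summit.HodgeConjecture.CorCM

end
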